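import Literature.MathematicalPhysics.QuantumFieldTheory.BalabanImbrieJaffe1984to88.BIJ88Eq5128Display

/-!
# `BalabanImbrieJaffe1984to88.BIJ88Eq5128Frame` — T. Bałaban, J. Imbrie, A. Jaffe, *Effective action and cluster properties of the
abelian Higgs model*, Commun. Math. Phys. **114** (1988) 257–315 [BalabanImbrieJaffe1988], **(5.12.8)** p. 303 [PDF 47] *"After the conditioning our
density assumes the following form"* — **THE PASSAGE (5.9.6) ⇒ (5.12.8) PROVED AT MEASURE LEVEL: THE CONDITIONING OF SECT. 5.12 AS AN OPERATION ON
THE TRANSLATED DISPLAY.**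

statement-level skeleton of published theorems with citation tags; proofs where landed; nothing here is a claim about the Yang–Mills mass gap

WHAT IS PROVED (theorems only; 0 `sorry`; no `Prop`-valued fact; standard axioms).  Start from LINE 1 OF (5.9.6) with a general bracket, this seat's
`BIJ88Eq596Display.IsDT (Π_b m_b) terms Λ Qu J ρ` (`u ~ Π_b m_b`: `𝒟u δ_{Ax}` is `Π_b axialLaw_b`, `𝒟u` is `Π_b du_b`), the family `terms` already
enlarged by the expansions of Sect. 5.11 / p. 300 (`BIJ88Eq5128Display.isDT_expand`).  HYPOTHESES, per term `t` with interior index sets `D t`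
(`Λ^{(k)c*c}_{10}`, `Λ^{(j)c*c}_{10}`, `Λ^{(k)}_{10}`):
 * `hfac` — the bracket FACTORS pointwise as (exterior factor, a function of the frozen configuration) × (positive weight `W_t`) × (interior factor):
   `J_t({u^{(j)}}, u′_Λ(u), v_Λ(u,v′), φ, ψ) = Xf_t(freeze q, v′, ψ) · W_t(q, v′, ψ) · B_t(q, v′, ψ)` — this is the content of (5.12.1)–(5.12.6) (p02's
   `BIJ88ExteriorForms5121`, `BIJ88LocTransl5126`, `BIJ88Measure5127` compute the three factors in coordinates: the exterior Gaussian forms, the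
   translations (5.12.4)/(5.12.6), the weight of (5.12.7)) together with Sect. 5.10's split `F = F′ + F^{m̄}` and the localization of the interaction
   `V^{(k)}` to `Λ^{(k)}_8`;
 * `hv` — LOCALITY: the block field `v_Λ(u, v′)` seen by the test function does not depend on the interior bond variables of `u` (a hypothesis
   here; in print it reflects the nesting `Λ^{(k)}_{10} ⊂ Λ̃^{(k)}_9 ⊂ Λ^{(k)}_9 ⊂ Λ̃^{(k)}_8 ⊂ … ` of p. 300 — each set obtained from the previous by
   deletions/collars — and line 2 of (5.12.8), `δ_{Λ^{(k)′*c}_1}(v/Qu^{(k)})`: `v` is constrained to the block averages only off `Λ^{(k)′*}_1`);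
 * `hWm`, `hW0`, `hWi` — the weight is jointly measurable, strictly positive, and integrable over each interior fibre (the Gaussian of (5.12.7));
 * `hJi` — the bracket is jointly integrable in `(v′, u, {u^{(j)}}, ψ, φ)` (the display (5.9.6) converges absolutely).
CONCLUSION (`isDC_of_isDT`): the SAME density satisfies the display (5.12.8) — this seat's `BIJ88Eq5128Display.IsDC` — with the exterior measures
`Π_{j≤k}du^{(j)}|_{Λ^{(j)c*}_{10}} dφ^{(k)}|_{Λ^{(k)c}_{10}}` (`Interior.extMeasure`), the exterior bracket `Xf_t · 𝒩_t` (`𝒩` = *"the last integral,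
without G"*, `Weight.normW`), the interior law `dμ^{(k)}_{Λ^{(k)}_{10}} = 𝒩⁻¹W_t·(interior product law)` (`Weight.condW`, a probability measure) and the
interior bracket `B_t`.  PROOF = the printed one: Fubini with `ψ` moved outside (`iter₄_eq_psi_cfg`), the exterior/interior product structure of the
configuration measure (`Interior.measurePreserving_split`), and the p. 300 identity *multiply and divide by 𝒩* in each exterior fibre
(`BIJ88Eq5128CondExpect.integral_condition_of_measurePreserving`); all `v′`/`ψ`-pointwise statements hold almost everywhere, which suffices under
the integral.  Instances: `isDC_of_isDT_axial` (`ν = 𝒟u δ_{Ax}`, via `isDT_axial_iff`), `isDC_of_isDT_field` (`ν = 𝒟u`), the printed-bracket form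
`isDC5128_of_isDT` (reading tables `Exterior5128`/`Interior5128` of `BIJ88Eq5128Display`), the composite with the expansions of Sect. 5.11 / p. 300
`isDC_of_isDT_expand` (`isDT_expand`, then conditioning), and the row's headline `eq5128_frame`: from `IsDT (𝒟u δ_{Ax}) terms Λ Q J ρ^L_{k+1}` (gen 9's
`BIJ88Eq596Frame.eq596_frame`) + expansions + factorization to `IsDC5128` over the enlarged family `({X_ω}, Λ_0, S_4, σ̃_1, Λ̃_9)`; and
`isDC_freeze_iff` (the exterior bracket may be read at the frozen configuration).
HONEST SCOPE.  The factorization `hfac` (the algebra (5.12.1)–(5.12.6) on the torus carriers), the locality `hv` and the positivity/integrability of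
the weight are HYPOTHESES (E-level content of rows C2.Eq5.12.1-5.12.7, C2.Def§5.10, C2.Eq5.11.1); the chart `u = e^{iηe_kA}` of the interior bond
variables and the closed-form evaluation of `𝒩` (the `Z`-factors and the forms `𝒬₇`, `𝒬₈`) are not performed; nothing of Sects. 5.13–5.15; no bound.
Seat p34 gen 10, file 4 (own lineage = the C1/C2 renormalization-transformation line at measure level).

CITATION HEADER (lean-in-tree rule).  Part of the lit-balaban TYPED SKELETON (HOME `run/shared/lean/pub/lit-balaban/`), PHASE-2 proof seat p34
gen 10 (unit `lit-balaban-p34-g10`; TAKING line HOME/STATUS.md 2026-08-22T00:14:36Z).  Row served: **`C2.Eq5.12.8`** of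
`HOME/lit-balaban-r16/ROWS-C2-part2.md` (owner r16); support `C2.Eq5.12.1-5.12.7` (p. 300 identity, (5.12.7)).
PDF held: `paper:balaban1988-cmp114-bij-abelian-higgs-effective-action` (journal page = PDF page + 256); pp. 297–303 rendered and read this session
(`renders/c2-p044.png` … `c2-p047.png` of the seat folder).  Imports this seat's `BIJ88Eq5128Display` (Literature + Mathlib only).
-/

namespace Literature.MathematicalPhysics.QuantumFieldTheory.BalabanImbrieJaffe1984to88.BIJ88Eq5128Frame

open Literature.MathematicalPhysics.QuantumFieldTheory.Balaban1983to89
open BIJ88Sect3Statements (U1)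
open BIJ85Sect1Model (HiggsField)
open BIJ88RenormTransf311 (axialMeasure axialBonds)
open BIJ88InductiveForm41 (Prev prevMeasure)
open BIJ88Eq596Display (uCut vCut vCut_apply IsDT)
open BIJ88Eq5128CondExpect (condNorm condMeasure condNorm_pos integral_condition_of_measurePreserving)
open BIJ88Eq5128Split (Cfg UCfg PCfg cfgMeasure prevPi prevMeasure_eq_prevPi Interior)
open BIJ88Eq5128Display (IsDC IsDC5128 isDC5128_iff termMeasure termIntegrand innerMeasure termMeasure_eq iter₄_eq_psi_cfg
  ae_integrable_section measurePreserving_psiOut psiOut axialLaw axialMeasure_eq_pi_axialLaw fieldMeasure_eq_pi_haar readEntry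
  exteriorBracket5128 interiorBracket5128 Exterior5128 Interior5128)
open BIJ88Eq5128Display.Weight (normW condW normW_glue integral_condW_glue)
open scoped BigOperators ENNReal
open _root_.MeasureTheory _root_.MeasureTheory.Measure Function Set

noncomputable section

variable {P : Params} {k : ℕ}

section Frame

variable {ι : Type*} {terms : Finset ι} {Λ : ι → Finset (PBond P (k+1))} {Qu : GaugeField P k U1 → GaugeField P (k+1) U1}
variable {m : PBond P k → Measure U1} [∀ b, IsProbabilityMeasure (m b)]
variable {J : ι → Prev P k → GaugeField P k U1 → GaugeField P (k+1) U1 → HiggsField P k → HiggsField P (k+1) → ℂ}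
variable {ρL : GaugeField P (k+1) U1 → HiggsField P (k+1) → ℂ}

/-- kernel: the test function read through the block field of the translated display is jointly measurable (in `(v′, u, {u^{(j)}}, ψ, φ)`).
[cite: BalabanImbrieJaffe1988, (5.9.6) p.297] -/
theorem measurable_test_vCut (hQu : Measurable Qu) (Λ₀ : Finset (PBond P (k+1))) {g : GaugeField P (k+1) U1 × HiggsField P (k+1) → ℂ}
    (hg : Measurable g) :
    Measurable fun r : GaugeField P (k+1) U1 × (UCfg P k × (PCfg P k × (HiggsField P (k+1) × HiggsField P k))) =>
      g (vCut Qu Λ₀ r.2.1 r.1, r.2.2.2.1) := by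
  refine hg.comp (Measurable.prodMk ?_ (measurable_fst.comp (measurable_snd.comp measurable_snd.snd)))
  refine measurable_pi_iff.mpr fun c => ?_
  by_cases hc : c ∈ Λ₀
  · simp only [vCut_apply, if_pos hc]; exact (measurable_pi_apply c).comp measurable_fst
  · simp only [vCut_apply, if_neg hc]; exact (measurable_pi_apply c).comp (hQu.comp measurable_snd.fst)

/-- kernel: the same on `(ψ, q)`. [cite: BalabanImbrieJaffe1988, (5.12.8) p.303] -/
theorem measurable_test_vCut₂ (hQu : Measurable Qu) (Λ₀ : Finset (PBond P (k+1))) (v' : GaugeField P (k+1) U1)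
    {g : GaugeField P (k+1) U1 × HiggsField P (k+1) → ℂ} (hg : Measurable g) :
    Measurable fun z : HiggsField P (k+1) × Cfg P k => g (vCut Qu Λ₀ z.2.1 v', z.1) := by
  refine hg.comp (Measurable.prodMk ?_ measurable_fst)
  refine measurable_pi_iff.mpr fun c => ?_
  by_cases hc : c ∈ Λ₀
  · simp only [vCut_apply, if_pos hc]; exact measurable_const
  · simp only [vCut_apply, if_neg hc]; exact (measurable_pi_apply c).comp (hQu.comp measurable_snd.fst)

/-- **The locality hypothesis `hv` from LOCALITY OF THE BLOCK AVERAGING.**  If the block average `(Qu u)(c)` at a block bond `c` off the cut-off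
`Λ₀` (where line 2 of (5.12.8) keeps `δ(v/Qu^{(k)})`) depends on `u` only through bonds outside the interior set `D.Ib` (`Λ^{(k)}_{10}` lies inside
`Λ^{(k)}_1` by the nesting of p. 300, the averaging blocks off `Λ^{(k)′*}_1` do not meet it), then the block field seen by the test function is unchanged
by freezing the interior bond variables. [cite: BalabanImbrieJaffe1988, (5.12.8) p.303] -/
theorem vCut_freeze_eq (D : Interior P k) (Λ₀ : Finset (PBond P (k+1))) {Qu : GaugeField P k U1 → GaugeField P (k+1) U1}
    (hloc : ∀ u u' : GaugeField P k U1, (∀ b, b ∉ D.Ib → u b = u' b) → ∀ c, c ∉ Λ₀ → Qu u c = Qu u' c)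
    (q : Cfg P k) (v' : GaugeField P (k+1) U1) : vCut Qu Λ₀ (D.freeze q).1 v' = vCut Qu Λ₀ q.1 v' := by
  funext c
  by_cases hc : c ∈ Λ₀
  · simp only [vCut_apply, if_pos hc]
  · simp only [vCut_apply, if_neg hc]
    refine hloc _ _ (fun b hb => ?_) c hc
    simp only [Interior.freeze, if_neg hb]

/-- **(5.9.6) ⇒ (5.12.8) AT MEASURE LEVEL: THE CONDITIONING.**  Data and hypotheses as in the module docstring: the translated display over
`u ~ Π_b m_b` (probability one-bond laws) with jointly integrable brackets (`hJi`), measurable `Qu` with the locality `hv`, interior index sets `D t`,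
the pointwise FACTORIZATION `hfac` of each bracket into an exterior factor `Xf_t ∘ freeze`, a jointly measurable strictly positive fibre-integrable
weight `W_t` and an interior factor `B_t`.  CONCLUSION: the same density satisfies (5.12.8) — `IsDC` with the exterior measures
`Π_{j≤k}du^{(j)}|_{Λ^{(j)c*}_{10}}dφ^{(k)}|_{Λ^{(k)c}_{10}}` (`extMeasure`), the exterior bracket `Xf_t · 𝒩_t`, the interior laws `dμ^{(k)}_{Λ^{(k)}_{10}} =
𝒩_t⁻¹W_t·(interior law)` (`condW`) and the interior bracket `B_t` — *"∫dφ|_{Λᶜ} F(φ|_{Λᶜ}) ∫dφ|_Λ e^{…} G(φ) = (…) ∫dφ|_{Λᶜ} F(φ|_{Λᶜ}) e^{…} × (1/𝒩)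
∫dφ|_Λ G(φ) e^{…}"* applied term by term to the configuration integral of (5.9.6). [cite: BalabanImbrieJaffe1988, (5.12.8) p.303] -/
theorem isDC_of_isDT (h : IsDT (Measure.pi m) terms Λ Qu J ρL) (hQu : Measurable Qu) (D : ι → Interior P k)
    (Xf B : ι → Cfg P k → GaugeField P (k+1) U1 → HiggsField P (k+1) → ℂ) (W : ι → Cfg P k → GaugeField P (k+1) U1 → HiggsField P (k+1) → ℝ)
    (hv : ∀ t ∈ terms, ∀ (q : Cfg P k) (v' : GaugeField P (k+1) U1), vCut Qu (Λ t) ((D t).freeze q).1 v' = vCut Qu (Λ t) q.1 v')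
    (hfac : ∀ t ∈ terms, ∀ (q : Cfg P k) (v' : GaugeField P (k+1) U1) (ψ : HiggsField P (k+1)),
      J t q.2.1 (uCut Qu (Λ t) q.1) (vCut Qu (Λ t) q.1 v') q.2.2 ψ = Xf t ((D t).freeze q) v' ψ * (W t q v' ψ : ℂ) * B t q v' ψ)
    (hWm : ∀ t ∈ terms, Measurable fun p : Cfg P k × (GaugeField P (k+1) U1 × HiggsField P (k+1)) => W t p.1 p.2.1 p.2.2)
    (hW0 : ∀ t ∈ terms, ∀ q v' ψ, 0 < W t q v' ψ)
    (hWi : ∀ t ∈ terms, ∀ (e : (D t).Ext) (v' : GaugeField P (k+1) U1) (ψ : HiggsField P (k+1)),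
      Integrable (fun i => W t ((D t).glue e i) v' ψ) ((D t).μInt m))
    (hJi : ∀ t ∈ terms, Integrable (termIntegrand Λ Qu J t) (termMeasure (Measure.pi m))) :
    IsDC terms Λ Qu (fun t => (D t).extMeasure m)
      (fun t q v' ψ => Xf t q v' ψ * (normW (D t) m (fun q' => W t q' v' ψ) q : ℂ))
      (fun t q v' ψ => condW (D t) m (fun q' => W t q' v' ψ) q) B ρL := by
  intro g hg hb
  obtain ⟨C, hC⟩ := hb
  rw [h g hg ⟨C, hC⟩]
  refine Finset.sum_congr rfl fun t ht => ?_
  -- the tested integrand of the term, jointly integrable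
  have hK : Integrable (fun r => termIntegrand Λ Qu J t r * g (vCut Qu (Λ t) r.2.1 r.1, r.2.2.2.1)) (termMeasure (Measure.pi m)) :=
    (hJi t ht).mul_bdd (measurable_test_vCut hQu (Λ t) hg).aestronglyMeasurable (Filter.Eventually.of_forall fun r => hC _)
  rw [termMeasure_eq] at hK
  -- a.e. in `v′` the inner integrand is integrable; there the printed computation applies
  refine integral_congr_ae ?_
  filter_upwards [hK.prod_right_ae] with v' hv'
  -- the inner integrand read on `(ψ, q)`
  set K₂ : HiggsField P (k+1) × Cfg P k → ℂ := fun z =>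
    J t z.2.2.1 (uCut Qu (Λ t) z.2.1) (vCut Qu (Λ t) z.2.1 v') z.2.2.2 z.1 * g (vCut Qu (Λ t) z.2.1 v', z.1) with hK₂def
  have hK₂ : Integrable K₂ ((volume : Measure (HiggsField P (k+1))).prod (cfgMeasure (Measure.pi m))) :=
    ((measurePreserving_psiOut (P := P) (k := k) (Measure.pi m)).integrable_comp_emb
      (psiOut (P := P) (k := k)).measurableEmbedding).mp hv'
  -- Step A: `ψ` outside, the configuration integral inside
  change ∫ U, ∫ prev, ∫ ψ, ∫ φ, K₂ (ψ, (U, (prev, φ))) ∂volume ∂volume ∂prevPi P k ∂(Measure.pi m) = _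
  rw [iter₄_eq_psi_cfg (Measure.pi m) hK₂]
  -- Step B: a.e. in `ψ`, condition the configuration integral on the exterior variables
  refine integral_congr_ae ?_
  filter_upwards [ae_integrable_section (Measure.pi m) hK₂] with ψ hψ
  set Dt := D t with hDt
  set F : Dt.Ext → ℂ := fun e => Xf t (Dt.glue e Dt.base) v' ψ * g (vCut Qu (Λ t) (Dt.glue e Dt.base).1 v', ψ) with hFdef
  set W' : Dt.Ext × Dt.Int → ℝ := fun p => W t (Dt.glue p.1 p.2) v' ψ with hW'def
  set G : Dt.Ext × Dt.Int → ℂ := fun p => B t (Dt.glue p.1 p.2) v' ψ with hGdef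
  -- the pointwise factorization, read through the split
  have hH : ∀ q : Cfg P k, K₂ (ψ, q) = F (Dt.split q).1 * (W' (Dt.split q) : ℂ) * G (Dt.split q) := by
    intro q
    simp only [hK₂def, hFdef, hW'def, hGdef, Interior.glue_split, ← Interior.freeze_eq_glue]
    rw [hfac t ht q v' ψ, hv t ht q v']
    ring
  have hW'm : Measurable W' := by
    have hgl : Measurable fun p : Dt.Ext × Dt.Int => Dt.glue p.1 p.2 := by
      simpa only [Interior.glue, Prod.mk.eta] using (Dt.split).symm.measurable
    exact (hWm t ht).comp (hgl.prodMk (measurable_const.prodMk measurable_const))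
  have hW'0 : ∀ p, 0 ≤ W' p := fun p => (hW0 t ht _ _ _).le
  have hW'i : ∀ e, Integrable (fun i => W' (e, i)) (Dt.μInt m) := fun e => hWi t ht e v' ψ
  have hN : ∀ e, 0 < condNorm (Dt.μInt m) (fun i => W' (e, i)) := fun e =>
    condNorm_pos (fun i => hW0 t ht _ _ _) (hW'i e)
  have hint : Integrable (fun p : Dt.Ext × Dt.Int => F p.1 * (W' p : ℂ) * G p) ((Dt.μExt m).prod (Dt.μInt m)) := by
    have h1 := (Dt.integrable_glue_iff m (F := fun q => K₂ (ψ, q))).mpr hψ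
    refine h1.congr (Filter.Eventually.of_forall fun p => ?_)
    simp only
    rw [hH (Dt.glue p.1 p.2), Interior.split_glue]
  have key := integral_condition_of_measurePreserving (Dt.measurePreserving_split m) F hW'm hW'0 hW'i hN G hint hH
  rw [key, Interior.integral_extMeasure]
  refine integral_congr_ae (Filter.Eventually.of_forall fun e => ?_)
  simp only [hFdef, hW'def, hGdef, normW_glue, integral_condW_glue]
  ring

/-- kernel: the translated display (5.9.6) depends on the bond-variable measure `ν` only through its value — transport along an equality of
measures on `UCfg P k = GaugeField P k U1` (used with `axialMeasure_eq_pi_axialLaw`: `𝒟u δ_{Ax} = Π_b axialLaw_b`). [cite: BalabanImbrieJaffe1988, (5.9.6) p.297] -/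
theorem isDT_of_measure_eq {ν ν' : Measure (UCfg P k)} (e : ν = ν') (h : IsDT ν terms Λ Qu J ρL) : IsDT ν' terms Λ Qu J ρL := by
  subst e; exact h

/-- **(5.9.6) over `𝒟u δ_{Ax}` is (5.9.6) over `Π_b axialLaw_b`.** [cite: BalabanImbrieJaffe1988, (5.9.6) p.297] -/
theorem isDT_axial_iff : IsDT (axialMeasure P k U1) terms Λ Qu J ρL ↔ IsDT (Measure.pi (axialLaw P k)) terms Λ Qu J ρL :=
  ⟨isDT_of_measure_eq (axialMeasure_eq_pi_axialLaw (P := P) (k := k)),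
    isDT_of_measure_eq (axialMeasure_eq_pi_axialLaw (P := P) (k := k)).symm⟩

/-- **Instance `ν = ∫𝒟u δ_{Ax}(u)(·)`** — the measure of (5.9.6)/(5.12.8) (`axialMeasure = Π_b axialLaw_b`). [cite: BalabanImbrieJaffe1988, (5.12.8) p.303] -/
theorem isDC_of_isDT_axial (h : IsDT (axialMeasure P k U1) terms Λ Qu J ρL) (hQu : Measurable Qu) (D : ι → Interior P k)
    (Xf B : ι → Cfg P k → GaugeField P (k+1) U1 → HiggsField P (k+1) → ℂ) (W : ι → Cfg P k → GaugeField P (k+1) U1 → HiggsField P (k+1) → ℝ)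
    (hv : ∀ t ∈ terms, ∀ (q : Cfg P k) (v' : GaugeField P (k+1) U1), vCut Qu (Λ t) ((D t).freeze q).1 v' = vCut Qu (Λ t) q.1 v')
    (hfac : ∀ t ∈ terms, ∀ (q : Cfg P k) (v' : GaugeField P (k+1) U1) (ψ : HiggsField P (k+1)),
      J t q.2.1 (uCut Qu (Λ t) q.1) (vCut Qu (Λ t) q.1 v') q.2.2 ψ = Xf t ((D t).freeze q) v' ψ * (W t q v' ψ : ℂ) * B t q v' ψ)
    (hWm : ∀ t ∈ terms, Measurable fun p : Cfg P k × (GaugeField P (k+1) U1 × HiggsField P (k+1)) => W t p.1 p.2.1 p.2.2)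
    (hW0 : ∀ t ∈ terms, ∀ q v' ψ, 0 < W t q v' ψ)
    (hWi : ∀ t ∈ terms, ∀ (e : (D t).Ext) (v' : GaugeField P (k+1) U1) (ψ : HiggsField P (k+1)),
      Integrable (fun i => W t ((D t).glue e i) v' ψ) ((D t).μInt (axialLaw P k)))
    (hJi : ∀ t ∈ terms, Integrable (termIntegrand Λ Qu J t) (termMeasure (Measure.pi (axialLaw P k)))) :
    IsDC terms Λ Qu (fun t => (D t).extMeasure (axialLaw P k))
      (fun t q v' ψ => Xf t q v' ψ * (normW (D t) (axialLaw P k) (fun q' => W t q' v' ψ) q : ℂ))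
      (fun t q v' ψ => condW (D t) (axialLaw P k) (fun q' => W t q' v' ψ) q) B ρL :=
  isDC_of_isDT (isDT_axial_iff.mp h) hQu D Xf B W hv hfac hWm hW0 hWi hJi

/-- **Instance `ν = 𝒟u`** (Haar one-bond laws). [cite: BalabanImbrieJaffe1988, (5.12.8) p.303] -/
theorem isDC_of_isDT_field (h : IsDT (fieldMeasure P k U1) terms Λ Qu J ρL) (hQu : Measurable Qu) (D : ι → Interior P k)
    (Xf B : ι → Cfg P k → GaugeField P (k+1) U1 → HiggsField P (k+1) → ℂ) (W : ι → Cfg P k → GaugeField P (k+1) U1 → HiggsField P (k+1) → ℝ)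
    (hv : ∀ t ∈ terms, ∀ (q : Cfg P k) (v' : GaugeField P (k+1) U1), vCut Qu (Λ t) ((D t).freeze q).1 v' = vCut Qu (Λ t) q.1 v')
    (hfac : ∀ t ∈ terms, ∀ (q : Cfg P k) (v' : GaugeField P (k+1) U1) (ψ : HiggsField P (k+1)),
      J t q.2.1 (uCut Qu (Λ t) q.1) (vCut Qu (Λ t) q.1 v') q.2.2 ψ = Xf t ((D t).freeze q) v' ψ * (W t q v' ψ : ℂ) * B t q v' ψ)
    (hWm : ∀ t ∈ terms, Measurable fun p : Cfg P k × (GaugeField P (k+1) U1 × HiggsField P (k+1)) => W t p.1 p.2.1 p.2.2)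
    (hW0 : ∀ t ∈ terms, ∀ q v' ψ, 0 < W t q v' ψ)
    (hWi : ∀ t ∈ terms, ∀ (e : (D t).Ext) (v' : GaugeField P (k+1) U1) (ψ : HiggsField P (k+1)),
      Integrable (fun i => W t ((D t).glue e i) v' ψ) ((D t).μInt fun _ => (HaarData.haar : Measure U1)))
    (hJi : ∀ t ∈ terms, Integrable (termIntegrand Λ Qu J t) (termMeasure (Measure.pi fun _ : PBond P k => (HaarData.haar : Measure U1)))) :
    IsDC terms Λ Qu (fun t => (D t).extMeasure fun _ => (HaarData.haar : Measure U1))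
      (fun t q v' ψ => Xf t q v' ψ * (normW (D t) (fun _ => (HaarData.haar : Measure U1)) (fun q' => W t q' v' ψ) q : ℂ))
      (fun t q v' ψ => condW (D t) (fun _ => (HaarData.haar : Measure U1)) (fun q' => W t q' v' ψ) q) B ρL :=
  haveI : ∀ _ : PBond P k, IsProbabilityMeasure (HaarData.haar : Measure U1) := fun _ => HaarData.isProb
  isDC_of_isDT (m := fun _ => (HaarData.haar : Measure U1)) h hQu D Xf B W hv hfac hWm hW0 hWi hJi

/-- **THE WHOLE PASSAGE (5.9.6) ⇒ (5.12.8): EXPANSIONS, THEN CONDITIONING.**  From the translated display over `terms` (`({X_ω}, Λ^{(k)}_0)`):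
(i) the expansions of Sect. 5.11 / p. 300 — every bracket `J_t` is pointwise the finite sum of new brackets `J′_s`, `π s = t`, over the enlarged family
`terms′` (`({X_ω}, Λ_0, S_4, σ̃_1, Λ̃_9)`; `BIJ88Eq5128Display.isDT_expand`), each jointly integrable; (ii) the conditioning of Sect. 5.12 — each new
bracket factors as in `isDC_of_isDT`.  CONCLUSION: the density satisfies (5.12.8) over `terms′` with the parents' cut-offs `Λ_{π s}`.
[cite: BalabanImbrieJaffe1988, (5.12.8) p.303] -/
theorem isDC_of_isDT_expand {ι' : Type*} [DecidableEq ι] (h : IsDT (Measure.pi m) terms Λ Qu J ρL) (hQu : Measurable Qu)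
    (terms' : Finset ι') (π : ι' → ι) (hπ : ∀ s ∈ terms', π s ∈ terms)
    (J' : ι' → Prev P k → GaugeField P k U1 → GaugeField P (k+1) U1 → HiggsField P k → HiggsField P (k+1) → ℂ)
    (hJ : ∀ t ∈ terms, ∀ prev u v φ ψ, J t prev u v φ ψ = ∑ s ∈ terms'.filter (fun s => π s = t), J' s prev u v φ ψ)
    (hJ'i : ∀ s ∈ terms', Integrable (termIntegrand (Λ ∘ π) Qu J' s) (termMeasure (Measure.pi m)))
    (D : ι' → Interior P k) (Xf B : ι' → Cfg P k → GaugeField P (k+1) U1 → HiggsField P (k+1) → ℂ)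
    (W : ι' → Cfg P k → GaugeField P (k+1) U1 → HiggsField P (k+1) → ℝ)
    (hv : ∀ s ∈ terms', ∀ (q : Cfg P k) (v' : GaugeField P (k+1) U1), vCut Qu (Λ (π s)) ((D s).freeze q).1 v' = vCut Qu (Λ (π s)) q.1 v')
    (hfac : ∀ s ∈ terms', ∀ (q : Cfg P k) (v' : GaugeField P (k+1) U1) (ψ : HiggsField P (k+1)),
      J' s q.2.1 (uCut Qu (Λ (π s)) q.1) (vCut Qu (Λ (π s)) q.1 v') q.2.2 ψ = Xf s ((D s).freeze q) v' ψ * (W s q v' ψ : ℂ) * B s q v' ψ)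
    (hWm : ∀ s ∈ terms', Measurable fun p : Cfg P k × (GaugeField P (k+1) U1 × HiggsField P (k+1)) => W s p.1 p.2.1 p.2.2)
    (hW0 : ∀ s ∈ terms', ∀ q v' ψ, 0 < W s q v' ψ)
    (hWi : ∀ s ∈ terms', ∀ (e : (D s).Ext) (v' : GaugeField P (k+1) U1) (ψ : HiggsField P (k+1)),
      Integrable (fun i => W s ((D s).glue e i) v' ψ) ((D s).μInt m)) :
    IsDC terms' (Λ ∘ π) Qu (fun s => (D s).extMeasure m)
      (fun s q v' ψ => Xf s q v' ψ * (normW (D s) m (fun q' => W s q' v' ψ) q : ℂ))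
      (fun s q v' ψ => condW (D s) m (fun q' => W s q' v' ψ) q) B ρL :=
  isDC_of_isDT (BIJ88Eq5128Display.isDT_expand h terms' π hπ J' hJ hQu hJ'i) hQu D Xf B W hv hfac hWm hW0 hWi hJ'i

omit [∀ b, IsProbabilityMeasure (m b)] in
/-- **(5.12.8) determines the density also after conditioning**: the exterior bracket may be read at the frozen configuration (`Xf_t(freeze q)·𝒩_t(q)`
instead of `Xf_t(q)·𝒩_t(q)`) without changing the display — the exterior integral only sees frozen configurations. [cite: BalabanImbrieJaffe1988, (5.12.8) p.303] -/
theorem isDC_freeze_iff (D : ι → Interior P k) (X B : ι → Cfg P k → GaugeField P (k+1) U1 → HiggsField P (k+1) → ℂ)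
    (cond : ι → Cfg P k → GaugeField P (k+1) U1 → HiggsField P (k+1) → Measure (Cfg P k)) :
    IsDC terms Λ Qu (fun t => (D t).extMeasure m) (fun t q v' ψ => X t ((D t).freeze q) v' ψ) cond B ρL ↔
      IsDC terms Λ Qu (fun t => (D t).extMeasure m) X cond B ρL := by
  have key : ∀ (g : GaugeField P (k+1) U1 × HiggsField P (k+1) → ℂ) t v' ψ,
      ∫ q, X t ((D t).freeze q) v' ψ * (∫ q', B t q' v' ψ ∂cond t q v' ψ) * g (vCut Qu (Λ t) q.1 v', ψ) ∂(D t).extMeasure m =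
        ∫ q, X t q v' ψ * (∫ q', B t q' v' ψ ∂cond t q v' ψ) * g (vCut Qu (Λ t) q.1 v', ψ) ∂(D t).extMeasure m := by
    intro g t v' ψ
    exact (D t).integral_extMeasure_freeze m (fun qf q => X t qf v' ψ * (∫ q', B t q' v' ψ ∂cond t q v' ψ) * g (vCut Qu (Λ t) q.1 v', ψ))
  constructor
  · intro hd g hg hb
    rw [hd g hg hb]
    refine Finset.sum_congr rfl fun t _ => ?_
    simp only [key g t]
  · intro hd g hg hb
    rw [hd g hg hb]
    refine Finset.sum_congr rfl fun t _ => ?_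
    simp only [key g t]

end Frame

/-! ## The printed brackets -/

section Printed

variable {ι : Type*} {terms : Finset ι} {Λ : ι → Finset (PBond P (k+1))} {Qu : GaugeField P k U1 → GaugeField P (k+1) U1}
variable {m : PBond P k → Measure U1} [∀ b, IsProbabilityMeasure (m b)]
variable {J : ι → Prev P k → GaugeField P k U1 → GaugeField P (k+1) U1 → HiggsField P k → HiggsField P (k+1) → ℂ}
variable {ρL : GaugeField P (k+1) U1 → HiggsField P (k+1) → ℂ}

/-- **(5.12.8) WITH THE TRANSCRIBED BRACKETS FROM (5.9.6)** — `isDC_of_isDT` with the exterior factor read from the table `Exterior5128` (at the frozen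
configuration) and the interior factor from `Interior5128`: if the bracket of the (expanded) translated display factors pointwise as
`(ζχζ′χ_{k+1}·Πg·ΠF′·Π(e^{−W₄}−1)·ΠZZ·exp[…])(frozen) × W_t × (χ′_{Λ₇}·ΠF^{m̄}·exp[−V^{(k)} − ΣW₅])` — the algebra of Sects. 5.10–5.12 — then the
density satisfies `IsDC5128`: the display (5.12.8) with lines 2–7 as the exterior bracket (times the factor `𝒩_t` the conditioning produces; its
closed Gaussian form is p02's `BIJ88ExteriorForms5121`), `dμ^{(k)}_{Λ^{(k)}_{10}} = 𝒩⁻¹W_t·(interior law)` and lines 7–8 as the interior bracket.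
[cite: BalabanImbrieJaffe1988, (5.12.8) p.303] -/
theorem isDC5128_of_isDT (DX : Exterior5128 P k ι) (DI : Interior5128 P k ι) (h : IsDT (Measure.pi m) terms Λ Qu J ρL)
    (hQu : Measurable Qu) (D : ι → Interior P k) (W : ι → Cfg P k → GaugeField P (k+1) U1 → HiggsField P (k+1) → ℝ)
    (hv : ∀ t ∈ terms, ∀ (q : Cfg P k) (v' : GaugeField P (k+1) U1), vCut Qu (Λ t) ((D t).freeze q).1 v' = vCut Qu (Λ t) q.1 v')
    (hfac : ∀ t ∈ terms, ∀ (q : Cfg P k) (v' : GaugeField P (k+1) U1) (ψ : HiggsField P (k+1)),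
      J t q.2.1 (uCut Qu (Λ t) q.1) (vCut Qu (Λ t) q.1 v') q.2.2 ψ =
        readEntry Λ Qu (exteriorBracket5128 DX) t ((D t).freeze q) v' ψ * (W t q v' ψ : ℂ) * readEntry Λ Qu (interiorBracket5128 DI) t q v' ψ)
    (hWm : ∀ t ∈ terms, Measurable fun p : Cfg P k × (GaugeField P (k+1) U1 × HiggsField P (k+1)) => W t p.1 p.2.1 p.2.2)
    (hW0 : ∀ t ∈ terms, ∀ q v' ψ, 0 < W t q v' ψ)
    (hWi : ∀ t ∈ terms, ∀ (e : (D t).Ext) (v' : GaugeField P (k+1) U1) (ψ : HiggsField P (k+1)),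
      Integrable (fun i => W t ((D t).glue e i) v' ψ) ((D t).μInt m))
    (hJi : ∀ t ∈ terms, Integrable (termIntegrand Λ Qu J t) (termMeasure (Measure.pi m))) :
    IsDC5128 DX DI terms Λ Qu (fun t => (D t).extMeasure m) (fun t q v' ψ => normW (D t) m (fun q' => W t q' v' ψ) q)
      (fun t q v' ψ => condW (D t) m (fun q' => W t q' v' ψ) q) ρL :=
  (isDC5128_iff DX DI terms Λ Qu _ _ _ ρL).mpr
    (isDC_of_isDT h hQu D (readEntry Λ Qu (exteriorBracket5128 DX)) (readEntry Λ Qu (interiorBracket5128 DI)) W hv hfac hWm hW0 hWi hJi)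

/-- **ROW C2.Eq5.12.8 — (5.9.6) ⇒ (5.12.8) WITH THE PRINTED MEASURE AND THE TRANSCRIBED BRACKETS.**  From LINE 1 OF (5.9.6) over `∫𝒟u δ_{Ax}`
(this seat's `BIJ88Eq596Frame.eq596_frame`: `IsDT (𝒟u δ_{Ax}) terms Λ Q J ρ^L_{k+1}`), the expansions of Sect. 5.11 / p. 300 (pointwise finite-sum
identities `hJ`, jointly integrable pieces `hJ'i`) and the factorization of each expanded bracket into (lines 2–7 of (5.12.8) at the frozen
configuration) × (positive weight) × (lines 7–8) (`hfac`, with the locality `hv` and the weight data): *"After the conditioning our density assumes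
the following form"* (5.12.8) — `IsDC5128` over the enlarged family, exterior measures `Π_{j≤k}du^{(j)}|_{Λ^{(j)c*}_{10}}dφ^{(k)}|_{Λ^{(k)c}_{10}}` built from
the one-bond laws of `𝒟u δ_{Ax}`, `dμ^{(k)}_{Λ^{(k)}_{10}} = 𝒩⁻¹W·(interior law)`. [cite: BalabanImbrieJaffe1988, (5.12.8) p.303] -/
theorem eq5128_frame {ι' : Type*} [DecidableEq ι] (DX : Exterior5128 P k ι') (DI : Interior5128 P k ι')
    (h : IsDT (axialMeasure P k U1) terms Λ Qu J ρL) (hQu : Measurable Qu)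
    (terms' : Finset ι') (π : ι' → ι) (hπ : ∀ s ∈ terms', π s ∈ terms)
    (J' : ι' → Prev P k → GaugeField P k U1 → GaugeField P (k+1) U1 → HiggsField P k → HiggsField P (k+1) → ℂ)
    (hJ : ∀ t ∈ terms, ∀ prev u v φ ψ, J t prev u v φ ψ = ∑ s ∈ terms'.filter (fun s => π s = t), J' s prev u v φ ψ)
    (hJ'i : ∀ s ∈ terms', Integrable (termIntegrand (Λ ∘ π) Qu J' s) (termMeasure (Measure.pi (axialLaw P k))))
    (D : ι' → Interior P k) (W : ι' → Cfg P k → GaugeField P (k+1) U1 → HiggsField P (k+1) → ℝ)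
    (hv : ∀ s ∈ terms', ∀ (q : Cfg P k) (v' : GaugeField P (k+1) U1), vCut Qu (Λ (π s)) ((D s).freeze q).1 v' = vCut Qu (Λ (π s)) q.1 v')
    (hfac : ∀ s ∈ terms', ∀ (q : Cfg P k) (v' : GaugeField P (k+1) U1) (ψ : HiggsField P (k+1)),
      J' s q.2.1 (uCut Qu (Λ (π s)) q.1) (vCut Qu (Λ (π s)) q.1 v') q.2.2 ψ =
        readEntry (Λ ∘ π) Qu (exteriorBracket5128 DX) s ((D s).freeze q) v' ψ * (W s q v' ψ : ℂ) *
          readEntry (Λ ∘ π) Qu (interiorBracket5128 DI) s q v' ψ)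
    (hWm : ∀ s ∈ terms', Measurable fun p : Cfg P k × (GaugeField P (k+1) U1 × HiggsField P (k+1)) => W s p.1 p.2.1 p.2.2)
    (hW0 : ∀ s ∈ terms', ∀ q v' ψ, 0 < W s q v' ψ)
    (hWi : ∀ s ∈ terms', ∀ (e : (D s).Ext) (v' : GaugeField P (k+1) U1) (ψ : HiggsField P (k+1)),
      Integrable (fun i => W s ((D s).glue e i) v' ψ) ((D s).μInt (axialLaw P k))) :
    IsDC5128 DX DI terms' (Λ ∘ π) Qu (fun s => (D s).extMeasure (axialLaw P k))
      (fun s q v' ψ => normW (D s) (axialLaw P k) (fun q' => W s q' v' ψ) q)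
      (fun s q v' ψ => condW (D s) (axialLaw P k) (fun q' => W s q' v' ψ) q) ρL :=
  (isDC5128_iff DX DI terms' (Λ ∘ π) Qu _ _ _ ρL).mpr
    (isDC_of_isDT_expand (isDT_axial_iff.mp h) hQu terms' π hπ J' hJ hJ'i D (readEntry (Λ ∘ π) Qu (exteriorBracket5128 DX))
      (readEntry (Λ ∘ π) Qu (interiorBracket5128 DI)) W hv hfac hWm hW0 hWi)

end Printed

end

end Literature.MathematicalPhysics.QuantumFieldTheory.BalabanImbrieJaffe1984to88.BIJ88Eq5128Frame
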